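import Summits.BirchSwinnertonDyer.Rank1Residual.Additive.KobayashiLayerSaturation
import Summits.BirchSwinnertonDyer.Rank1Residual.Additive.CyclotomicTowerLocalTorsionPadic
import Literature.NumberTheory.EllipticCurves.PointCountHasseInvariantProofs
import HarnessLib

/-!
# `hsum` under the SINGLE structural hypothesis `(U n)_{ℚ_p} = Stab(ζ_{p^{n+1}})`: the torsion
# hypothesis `htors` (Prop. 8.7, by gen 32's descent + Serre's degree bound at the bottom layer
# `ℚ_p(μ_p)`) and the saturation hypothesis `hsat` (file KobayashiLayerSaturation) of
# `localFixedPointsOfEmb_le_sup_towerSigned` are DISCHARGED for every such tower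
# (cell `b2b-bsdres`, CLASS-CLOSURE lane, class O10 — x1b GEN 34, class lead; file 38 of the local series)

HONEST FRAMING (cell `b2b-bsdres`, run/shared/lean/b2b/bsd-rank1-residual/, verbatim in every
file): the goal of the cell is to DELETE the COMBINATION-SHAPED residual classes of the
Birch–Swinnerton-Dyer formula for ALL analytic-rank `≤ 1` elliptic curves over `ℚ` — "full BSD
formula for every rank `≤ 1` curve in class `C`" assembled STRICTLY from published theorems — so
that the rank-`≤ 1` remainder becomes exactly the CONSTRUCTION-SHAPED classes, which are TYPED
(missing-input `Prop`s), NOT attempted. This is not "finishing BSD". CLASS-CLOSURE lane: prove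
what is provable now; shrink each hard class to its core with data; no claim beyond stated classes;
research routes on CONSTRUCTION-SHAPED X12 / O10; census / instrument output = EVIDENCE / conjecture
items, NEVER a Literature fact; `RESIDUAL-MAP.md` marks change only by signed lines. THIS FILE:
TOOL THEOREMS ONLY — no definition, no named Literature fact, no Summits-side fact `def … : Prop`,
no `sorry`, axioms standard; nothing is booked; no label / mark / count / sub-cell moves; O10 stays
OPEN / CONSTRUCTION-SHAPED; nothing about `BSD(W, p)` of any pair is claimed.

## Content (`ι : K̄ → ℚ̄_p`, `W/K` elliptic, `U : ℕ → Subgroup Γ_K` antitone, normal, finite index,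
## `(U n)_{ℚ_p} = Stab(ζ_{p^{n+1}})`, `M/ℤ_p` with `M ⊗ ℚ̄_p = W ⊗ ℚ̄_p`, `M mod p` elliptic, `a_p(M) = 0`,
## `p` odd)

* §1 Model bookkeeping: `a_p(M) = 0 ⟹ A_p(M) ∈ pℤ_p` (the Hasse coefficient; Silverman V.4.1(a) via
  the tree's `cast_card_add_one_sub_natCard_point`).
* §2 `[Stab(ζ_{p^{m+1}}) : Stab(ζ_{p^{n+1}})] = p^{n−m}`; **Prop. 8.7 for the tower `U`**:
  `E(K_{n,v})[p^∞] = 0` for all `n` — bottom layer `ℚ_p(μ_p)` of degree `p − 1 < (p² − 1)/2` by gen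
  32's `eq_zero_of_prime_smul_eq_zero_localFixedPointsOfEmb_padic`, then the `p`-group descent
  `eq_zero_of_prime_smul_eq_zero_localFixedPointsOfEmb_tower`.
* §3 **`localFixedPointsOfEmb_le_sup_towerSigned_of_stab`**: `E(K_{n,v}) ≤ E⁺(K_{n,v}) ⊔ E⁻(K_{n,v})`
  for every `n` — Kobayashi Prop. 8.12 ii) (generation half) with NO torsion and NO saturation
  hypothesis (gen 33's `localFixedPointsOfEmb_le_sup_towerSigned` + §2 + `hsat_of_stab`).

References: [Kobayashi2003] Prop. 8.7 (p. 16), Prop. 8.11, Prop. 8.12 ii) (pp. 17–18);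
[SilvermanAEC2009] V.4.1(a), VII.2.1; [SerreInventiones1972] §1.11 Prop. 12.
-/

noncomputable section

open scoped Classical

namespace Summit.BirchSwinnertonDyer.Rank1Residual.Additive

open Literature.NumberTheory.EllipticCurves Literature.NumberTheory.GaloisRepresentations
  WeierstrassCurve PadicCyclotomicTower BallEval Field

variable {p : ℕ} [hp : Fact p.Prime]

/-! ## §1 `a_p = 0 ⟹ A_p ∈ pℤ_p` -/

/-- **`a_p(M) = 0 ⟹ A_p(M) ∈ pℤ_p`** for a `ℤ_p`-model with `M mod p` elliptic, `p` odd: the trace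
`a_p = p + 1 − #Ẽ(𝔽_p)` is the Hasse coefficient `A_p` modulo `p` (Silverman V.4.1(a), the tree's
`cast_card_add_one_sub_natCard_point`), and `A_p(M mod p) = A_p(M) mod p` (`map_hasseCoeff`).
[cite: SilvermanAEC2009, V.4.1] -/
theorem hasseCoeff_mem_maximalIdeal_of_tr_eq_zero (hp2 : p ≠ 2) (M : WeierstrassCurve ℤ_[p])
    [(M.map PadicInt.toZMod).IsElliptic]
    (htr : Literature.NumberTheory.EllipticCurves.HasseManin.tr (M.map PadicInt.toZMod) = 0) :
    M.hasseCoeff p ∈ IsLocalRing.maximalIdeal ℤ_[p] := by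
  have h2 : ringChar (ZMod p) ≠ 2 := by rwa [ZMod.ringChar_zmod_n]
  have key := (M.map PadicInt.toZMod).cast_card_add_one_sub_natCard_point h2
  have htr' : ((Fintype.card (ZMod p) : ℤ) + 1 - Nat.card (M.map PadicInt.toZMod).toAffine.Point : ℤ) = 0 := htr
  rw [htr', Int.cast_zero, ZMod.card] at key
  have hA : (M.map PadicInt.toZMod).hasseCoeff p = 0 := by rw [hasseCoeff]; exact key.symm
  rw [map_hasseCoeff] at hA
  rw [← PadicInt.ker_toZMod, RingHom.mem_ker]
  exact hA

/-! ## §2 Prop. 8.7 for a tower with `(U n)_{ℚ_p} = Stab(ζ_{p^{n+1}})` -/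

/-- **`[Stab(ζ_{p^{m+1}}) : Stab(ζ_{p^{n+1}})] ∣ pⁿ`** for `m ≤ n` (it equals `p^{n−m}`:
`φ(p^{n+1}) = p^{n−m} φ(p^{m+1})`). [cite: SerreLocalFields1979, Ch. IV §4] -/
theorem index_subgroupOf_stab_succ_dvd_pow {m n : ℕ} (hmn : m ≤ n) :
    ((stab p (n + 1)).subgroupOf (stab p (m + 1))).index ∣ p ^ n := by
  have hle : stab p (n + 1) ≤ stab p (m + 1) := stab_antitone p (by omega)
  have h := Subgroup.relIndex_mul_index hle
  rw [index_stab', index_stab', Nat.totient_prime_pow_succ hp.out, Nat.totient_prime_pow_succ hp.out] at h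
  have hpos : 0 < p ^ m * (p - 1) := Nat.mul_pos (pow_pos hp.out.pos m) (Nat.sub_pos_of_lt hp.out.one_lt)
  have hrel : (stab p (n + 1)).relIndex (stab p (m + 1)) = p ^ (n - m) := by
    refine Nat.eq_of_mul_eq_mul_right hpos ?_
    rw [h, ← mul_assoc, ← pow_add, Nat.sub_add_cancel hmn]
  change (stab p (n + 1)).relIndex (stab p (m + 1)) ∣ p ^ n
  rw [hrel]
  exact pow_dvd_pow p (Nat.sub_le n m)

/-- `[Γ_{ℚ_p} : Stab(ζ_p)] = p − 1` is non-zero and `< (p² − 1)/2` for `p` odd. [folklore] -/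
theorem index_stab_one_ne_zero_and_lt (hp2 : p ≠ 2) :
    (stab p 1).index ≠ 0 ∧ (stab p 1).index < (p ^ 2 - 1) / 2 := by
  rw [index_stab', pow_one, Nat.totient_prime hp.out]
  have h3 : 3 ≤ p := by
    rcases hp.out.eq_two_or_odd' with h | h
    · exact absurd h hp2
    · have := hp.out.two_le; rcases h with ⟨k, hk⟩; omega
  have h9 : 3 * p ≤ p ^ 2 := by rw [sq]; exact Nat.mul_le_mul_right p h3
  constructor <;> omega

section Tower

variable {K : Type} [Field K] [Algebra K ℚ_[p]]
  (ι : AlgebraicClosure K →ₐ[K] AlgebraicClosure ℚ_[p]) (W : WeierstrassCurve K) [W.IsElliptic]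
  (U : ℕ → Subgroup (Field.absoluteGaloisGroup K)) [hUN : ∀ n, (U n).Normal]

/-- **Prop. 8.7 for EVERY tower with `(U n)_{ℚ_p} = Stab(ζ_{p^{n+1}})`**: for `W/K` elliptic with a
good supersingular `ℤ_p`-model `M` (`Δ(M) ∈ ℤ_p^×`, `A_p(M) ∈ pℤ_p`, `M ⊗ ℚ̄_p = W ⊗ ℚ̄_p`), `p` odd,
and `U n ⊴ Γ_K` with local subgroups the stabilisers of `ζ_{p^{n+1}}`: `E(K_{n,v})[p^k] = 0` for all
`n, k` — the bottom layer `K_{0,v} = ℚ_p(μ_p)` has degree `p − 1 < (p² − 1)/2` (gen 32,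
`eq_zero_of_prime_smul_eq_zero_localFixedPointsOfEmb_padic`, Serre 1972 Prop. 12), and
`[K_{n,v} : K_{0,v}] = pⁿ` feeds the `p`-group descent
(`eq_zero_of_prime_smul_eq_zero_localFixedPointsOfEmb_tower`). [cite: Kobayashi2003, Prop. 8.7 (p. 16)]
[cite: SerreInventiones1972, §1.11 Prop. 12] -/
theorem eq_zero_of_prime_pow_smul_eq_zero_localFixedPointsOfEmb_of_stab (hp2 : p ≠ 2)
    (M : WeierstrassCurve ℤ_[p]) (hΔ : IsUnit M.Δ) (hA : M.hasseCoeff p ∈ IsLocalRing.maximalIdeal ℤ_[p])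
    (hWM : M.baseChange (AlgebraicClosure ℚ_[p]) = W.baseChange (AlgebraicClosure ℚ_[p]))
    (hU : ∀ n, localSubgroupOfEmb (U n) ι = stab p (n + 1)) (n k : ℕ) :
    ∀ Q ∈ localFixedPointsOfEmb ι W (U n), p ^ k • Q = 0 → Q = 0 := by
  have h₀ : ∀ Q ∈ localFixedPointsOfEmb ι W (U 0), p • Q = 0 → Q = 0 := by
    obtain ⟨h0, hlt⟩ := index_stab_one_ne_zero_and_lt (p := p) hp2
    refine eq_zero_of_prime_smul_eq_zero_localFixedPointsOfEmb_padic ι W hp2 M hΔ hA hWM (U 0) ?_ ?_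
    · rw [hU 0]; exact h0
    · rw [hU 0]; exact hlt
  have hn : ∀ Q ∈ localFixedPointsOfEmb ι W (U n), p • Q = 0 → Q = 0 :=
    eq_zero_of_prime_smul_eq_zero_localFixedPointsOfEmb_tower ι W U n
      (fun m hm => ⟨n, by rw [hU n, hU m]; exact index_subgroupOf_stab_succ_dvd_pow hm⟩) h₀
  exact eq_zero_of_pow_smul_eq_zero_of_forall _ hn k

variable [hUf : ∀ n, (U n).FiniteIndex] (M : WeierstrassCurve ℤ_[p])
  [hE : (M.map PadicInt.Coe.ringHom).IsElliptic] [hEt : (M.map PadicInt.toZMod).IsElliptic]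

variable {ι W U M}

/-! ## §3 `hsum` with NO torsion and NO saturation hypothesis -/

/-- **Kobayashi Prop. 8.12 ii) (generation half) for EVERY tower with `(U n)_{ℚ_p} = Stab(ζ_{p^{n+1}})`,
NO torsion / saturation hypothesis.** Let `U` be an antitone tower of normal finite-index subgroups of
`Γ_K` whose local subgroups at `ι` are the stabilisers `Stab(ζ_{p^{n+1}}) ≤ Gal(ℚ̄_p/ℚ_p)`, `p` odd,
`W/K` elliptic with a `ℤ_p`-model `M` (`M ⊗ ℚ̄_p = W ⊗ ℚ̄_p`) of good reduction with `a_p(M) = 0`. Then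
`E(K_{n,v}) ≤ E⁺(K_{n,v}) ⊔ E⁻(K_{n,v})` for every `n` (gen 33's `localFixedPointsOfEmb_le_sup_towerSigned`
with `htors` from §2 and `hsat` from `hsat_of_stab`). [cite: Kobayashi2003, Prop. 8.12] -/
theorem localFixedPointsOfEmb_le_sup_towerSigned_of_stab (hp2 : p ≠ 2)
    (htr : Literature.NumberTheory.EllipticCurves.HasseManin.tr (M.map PadicInt.toZMod) = 0)
    (hUa : Antitone U) (hU : ∀ n, localSubgroupOfEmb (U n) ι = stab p (n + 1))
    (hWM : M.baseChange (AlgebraicClosure ℚ_[p]) = W.baseChange (AlgebraicClosure ℚ_[p])) (n : ℕ) :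
    localFixedPointsOfEmb ι W (U n) ≤
      towerSignedLocalPointsOfEmb U ι W 1 n ⊔ towerSignedLocalPointsOfEmb U ι W (-1) n :=
  localFixedPointsOfEmb_le_sup_towerSigned hp2 htr hUa hU hWM
    (fun m P hP k => eq_zero_of_prime_pow_smul_eq_zero_localFixedPointsOfEmb_of_stab ι W U hp2 M
      (isUnit_Δ_of_isElliptic_toZMod p M) (hasseCoeff_mem_maximalIdeal_of_tr_eq_zero hp2 M htr) hWM hU m k P hP)
    (hsat_of_stab htr hU hWM) n

/-- The same, as an EQUALITY `E(K_{n,v}) = E⁺(K_{n,v}) ⊔ E⁻(K_{n,v})` (`E^± ≤ E` trivially).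
[cite: Kobayashi2003, Prop. 8.12] -/
theorem sup_towerSigned_eq_localFixedPointsOfEmb_of_stab (hp2 : p ≠ 2)
    (htr : Literature.NumberTheory.EllipticCurves.HasseManin.tr (M.map PadicInt.toZMod) = 0)
    (hUa : Antitone U) (hU : ∀ n, localSubgroupOfEmb (U n) ι = stab p (n + 1))
    (hWM : M.baseChange (AlgebraicClosure ℚ_[p]) = W.baseChange (AlgebraicClosure ℚ_[p])) (n : ℕ) :
    towerSignedLocalPointsOfEmb U ι W 1 n ⊔ towerSignedLocalPointsOfEmb U ι W (-1) n =
      localFixedPointsOfEmb ι W (U n) :=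
  le_antisymm (sup_le (towerSignedLocalPointsOfEmb_le U ι W 1 n) (towerSignedLocalPointsOfEmb_le U ι W (-1) n))
    (localFixedPointsOfEmb_le_sup_towerSigned_of_stab hp2 htr hUa hU hWM n)

end Tower

end Summit.BirchSwinnertonDyer.Rank1Residual.Additive

end
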